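import Summits.BirchSwinnertonDyer.BirchSwinnertonDyer.Theorems.Rank1ResidualIntModelReduction
import Summits.BirchSwinnertonDyer.Rank1Residual.GaloisImage.FrobeniusOrderWitness
import Summits.BirchSwinnertonDyer.Rank1Residual.X11b.CertificateCheckBridge
import Summits.BirchSwinnertonDyer.Rank1Residual.X11b.AnticyclotomicLinks
import Summits.BirchSwinnertonDyer.Rank1Residual.X11b.AnticyclotomicEmbedding
import Literature.NumberTheory.EllipticCurves.BurungaleSkinner2023.Curve14a1TwistsCertificate
import Literature.NumberTheory.EllipticCurves.RationalIsogenyFrobeniusCriterion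
import Literature.NumberTheory.Automorphic.ThorneQInfinityModularSurjectivityProofs
import Literature.NumberTheory.EllipticCurves.Rank1Residual.X11Three
import Literature.NumberTheory.EllipticCurves.HeegnerHypothesisKroneckerProofs
import Literature.NumberTheory.EllipticCurves.HeegnerPointsImaginaryQuadraticProofs
import Literature.NumberTheory.QuadraticFields.FundamentalDiscriminant
import Mathlib.Tactic.NormNum.LegendreSymbol
import HarnessLib

/-!
# `UniversalToricDescent.TwinAlgMuZeroAtThree` (stmt-BirchSwinnertonDyer-24737), negative-side
# support I: the bucket-B HABITAT of the hypotheses (this file does NOT refute the crux)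

Kernel-checked by-products of the disprover seat on the crux `TwinAlgMuZeroAtThree` ("(B3) TWIN
ALGEBRAIC `μ = 0` at `p = 3`, R2 text": for `E'/ℚ` with `ρ̄_{E',3}` onto, `K` Heegner for `N_{E'}`
with `d_K` odd, `3` split, and `E'` at `3` either multiplicative with `3 ∤ ord₃ Δ_min` or good
supersingular with `a₃ = 0`, the primitive anticyclotomic Selmer dual `X_{∅,0}(E'/K_∞^{ac})` is
`Λ`-torsion with a characteristic generator having a `3`-adic unit coefficient).

What is proved here (no new definition; no statement of the route is asserted positively):

* §0 `exists_two_primes_of_splitsIn` — for `[K:ℚ] = 2` and `p` split, two DISTINCT primes `𝔭 ∋ p`,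
  `𝔭' ∋ p` exist and `𝔭` has `e = f = 1`: the binder block `𝔭, e = f = 1, 𝔭' ≠ 𝔭` of the crux is
  inhabited under the crux's own hypotheses (`splitsIn_three_of_heegner`).
* §1 the integer model `15a1 = [1,1,1,−10,−10]` (`Δ`, `c₄` from the tree's `Thorne2019.fifteenA1_int_Δ/c₄`):
  `N = 15`, `Δ = 3⁴·5⁴` (multiplicative at `3`,
  `ord₃ Δ_min = 4`, so `3 ∤ ord₃ Δ_min`), `ρ̄₃` ONTO by the Frobenius witnesses `ℓ = 7` (irreducible)
  and `ℓ = 37` (order `3`), all in the kernel.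
* §2 **bucket-B habitat**: with `K` of discriminant `−11` (Heegner for `15`, odd),
  `exists_bucketB_antecedents` — EVERY hypothesis of `TwinAlgMuZeroAtThree` except the (unused,
  modularity) binder `Dt'` holds simultaneously; `exists_bucketB_antecedents_with_parametrization`
  adds `Dt'` under the displayed named fact `nonempty_modularParametrizationData`
  (Breuil–Conrad–Diamond–Taylor). CONSEQUENCE: the crux is NOT vacuously true on its multiplicative
  branch; a proof must produce `Λ`-torsion and `μ = 0` of `X_{∅,0}(15a1/K_∞)` — the open twin at
  `p = 3` of [BCS2024 = arXiv:2405.00270, Thm. 4.2.1 (b)], not in print for `3 ∥ N`.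
  (Companions: `HabitatC0.lean` — the good-supersingular branch, `17a1`; `GuardCuts.lean` — the R2
  guards are proper cuts of the R1 text.)

Disprover seat `cdisprove-stmt-BirchSwinnertonDyer-24737-g0` (refuter lineage), 2026-08-29. Verdict on
the crux itself: "no kill" — every junk instance (`X = 0`, `char = ⊤`) and every rank-one unit-data
instance (tree `UniversalToricDescentTwinAlgMuUnitPairs`) makes the conclusion TRUE; the load-bearing
content is `Λ`-torsion ∧ `μ_alg = 0` of `X_{∅,0}` on buckets B/C₀, for which no `μ > 0` mechanism
survives `ρ̄₃` onto + Heegner + `3` split. See the crux workfile `Cruxes/TwinAlgMuZeroAtThree/Disproof.lean`.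

References: [CremonaAlgorithms1997] Table 1 (curve 15a1); [SilvermanAEC2009] VII.1 Rem. 1.1, VII.5
Prop. 5.1; [Silverman1994] IV.10.2; [Serre1972] §2.4 Prop. 15, §2.8 Prop. 19; [Marcus1977] Ch. 2
Thm. 1, Ch. 3 Thm. 25; [GrossLMS1991] §1; [IrelandRosen1990] §8.1; [BCDTJAMS2001] Thm. A.
-/

noncomputable section

open scoped Classical

-- D-0017: single-problem summit, so `Summit.BirchSwinnertonDyer.BirchSwinnertonDyer.…` repeats a
-- namespace BY DESIGN.
set_option linter.dupNamespace false

namespace Summit.BirchSwinnertonDyer.BirchSwinnertonDyer.Theorems.TwinAlgMuZeroAtThree.Negative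

open WeierstrassCurve NumberField IsDedekindDomain
open Literature.NumberTheory.EllipticCurves Literature.NumberTheory.EllipticCurves.Rank1Residual
open Literature.NumberTheory.EllipticCurves.ModularForms (ModularParametrizationData
  nonempty_modularParametrizationData)
open Literature.NumberTheory.EllipticCurves.BurungaleSkinner2023 (conductorNorm_baseChange_int_of_isCoprime
  hasMultiplicativeReductionAtPrime_baseChange_int_of_isCoprime
  hasGoodReductionAtPrime_baseChange_int_of_not_dvd)
open Literature.NumberTheory.EllipticCurves.Rank1Residual.X11RankOneCertificates (countPoints)
open Summit.BirchSwinnertonDyer.BirchSwinnertonDyer.Rank1Residual (IntModel.integralModelInt_eq_of_map_eq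
  IntModel.minimalDiscriminantInt_eq IntModel.frobeniusTrace_eq IntModel.padicValInt_eq_of_dvd_of_not_dvd)
open Summit.BirchSwinnertonDyer.Rank1Residual.X11b
open Summit.BirchSwinnertonDyer.Rank1Residual.GaloisImage
open Literature.NumberTheory.Automorphic.Thorne2019 (fifteenA1_int_Δ fifteenA1_int_c₄)

/-! ### §0 Two distinct primes above a split prime -/

/-- **Two distinct primes above a split prime.** For `[K:ℚ] = 2` and `p` split in `K`
(`SplitsIn K p`: two primes of `𝓞_K` over `(p)`), there are primes `𝔭 ∋ p` with `e(𝔭|p) = f(𝔭|p) = 1`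
and `𝔭' ∋ p`, `𝔭' ≠ 𝔭` (the fundamental identity; tree `placesOver_trichotomy_of_finrank_eq_two`,
`ncard_primesOver_span_eq`). [folklore] -/
theorem exists_two_primes_of_splitsIn {K : Type} [Field K] [NumberField K]
    (h2 : Module.finrank ℚ K = 2) {p : ℕ} [Fact p.Prime] (hs : SplitsIn K p) :
    ∃ 𝔭 𝔭' : HeightOneSpectrum (𝓞 K), ((p : ℕ) : 𝓞 K) ∈ 𝔭.asIdeal ∧
      𝔭.asIdeal.ramificationIdx (𝓞 ℚ) = 1 ∧ 𝔭.asIdeal.inertiaDeg (𝓞 ℚ) = 1 ∧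
      ((p : ℕ) : 𝓞 K) ∈ 𝔭'.asIdeal ∧ 𝔭' ≠ 𝔭 := by
  have hcard : {w : HeightOneSpectrum (𝓞 K) | w.under (𝓞 ℚ) = ratPlace p}.ncard = 2 := by
    rw [← ncard_primesOver_span_eq K (ratPlace p), primesEquiv_ratPlace]; exact hs
  rcases placesOver_trichotomy_of_finrank_eq_two K h2 (ratPlace p) with
    ⟨w₁, w₂, hne, hset, hef⟩ | ⟨w, hset, -, -⟩ | ⟨w, hset, -, -⟩
  · have h₁ : w₁ ∈ {w : HeightOneSpectrum (𝓞 K) | w.under (𝓞 ℚ) = ratPlace p} := by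
      rw [hset]; exact Set.mem_insert _ _
    have h₂ : w₂ ∈ {w : HeightOneSpectrum (𝓞 K) | w.under (𝓞 ℚ) = ratPlace p} := by
      rw [hset]; exact Set.mem_insert_of_mem _ rfl
    exact ⟨w₁, w₂, mem_of_under_eq_ratPlace h₁, (hef w₁ h₁).1, (hef w₁ h₁).2,
      mem_of_under_eq_ratPlace h₂, hne.symm⟩
  · rw [hset, Set.ncard_singleton] at hcard; exact absurd hcard (by norm_num)
  · rw [hset, Set.ncard_singleton] at hcard; exact absurd hcard (by norm_num)

/-- Under the Heegner hypothesis for `N` with `3 ∣ N`, the prime `3` splits in `K`. [folklore] -/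
theorem splitsIn_three_of_heegner {K : Type} [Field K] [NumberField K] {N : ℕ} (h3 : 3 ∣ N)
    (hH : SatisfiesHeegnerHypothesis N K) : SplitsIn K 3 :=
  hH 3 Nat.prime_three h3

/-! ### §1 The integer model `15a1 = [1, 1, 1, −10, −10]` (bucket B at `p = 3`) -/

/-- `Δ(15a1)` and `c₄(15a1)` are coprime (semistable). [cite: SilvermanAEC2009, VII.5 Prop. 5.1(b)] -/
theorem M15_coprime : IsCoprime (⟨1, 1, 1, -10, -10⟩ : WeierstrassCurve ℤ).Δ
    (⟨1, 1, 1, -10, -10⟩ : WeierstrassCurve ℤ).c₄ := by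
  rw [fifteenA1_int_Δ, fifteenA1_int_c₄, Int.isCoprime_iff_gcd_eq_one]; decide

/-- `15a1` is an elliptic curve. [cite: CremonaAlgorithms1997, Table 1 (curve 15a1)] -/
theorem isElliptic_15a1 : ((⟨1, 1, 1, -10, -10⟩ : WeierstrassCurve ℤ).baseChange ℚ).IsElliptic :=
  Literature.NumberTheory.EllipticCurves.isElliptic_baseChange_int _ (by rw [fifteenA1_int_Δ]; decide)

/-- Cremona's model `15a1` is globally minimal (`|Δ| < 3¹²`, `Δ` odd).
[cite: SilvermanAEC2009, VII.1 Remark 1.1] -/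
theorem isGloballyMinimal_15a1 :
    ((⟨1, 1, 1, -10, -10⟩ : WeierstrassCurve ℤ).baseChange ℚ).IsGloballyMinimal :=
  isGloballyMinimal_baseChange_int _ (forall_not_pow_dvd_or_of_bound _ (B := 3)
    (by rw [fifteenA1_int_Δ]; decide) (by rw [fifteenA1_int_Δ]; decide) (by
      intro p hp hpr
      have hp3 : p < 3 := Finset.mem_range.mp hp
      interval_cases p
      · exact absurd hpr (by decide)
      · exact absurd hpr (by decide)
      · left; rw [fifteenA1_int_Δ]; decide))

/-- The tree's integral model of `15a1 ⊗ ℚ` is the integer equation itself. [folklore] -/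
theorem integralModelInt_15a1 [((⟨1, 1, 1, -10, -10⟩ : WeierstrassCurve ℤ).baseChange ℚ).IsGloballyMinimal] :
    integralModelInt ((⟨1, 1, 1, -10, -10⟩ : WeierstrassCurve ℤ).baseChange ℚ) =
      (⟨1, 1, 1, -10, -10⟩ : WeierstrassCurve ℤ) :=
  IntModel.integralModelInt_eq_of_map_eq _ (baseChange_int_eq_map _).symm

/-- **The conductor of `15a1` is `15 = 3·5`.** [cite: CremonaAlgorithms1997, Table 1 (curve 15a1)] -/
theorem conductorNorm_15a1 : ((⟨1, 1, 1, -10, -10⟩ : WeierstrassCurve ℤ).baseChange ℚ).conductorNorm ℤ = 15 := by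
  haveI := isElliptic_15a1
  refine conductorNorm_baseChange_int_of_isCoprime _ M15_coprime (k := 4) ?_ ?_ ?_
  · decide +kernel
  · rw [fifteenA1_int_Δ]; decide
  · rw [fifteenA1_int_Δ]; decide

/-- **`15a1` is multiplicative at `3`** (`3 ∣ Δ`, `(Δ, c₄) = 1`). [cite: SilvermanAEC2009, VII.5 Prop. 5.1(b)] -/
theorem mult_three_15a1 : Mult ((⟨1, 1, 1, -10, -10⟩ : WeierstrassCurve ℤ).baseChange ℚ) 3 := by
  haveI := isElliptic_15a1
  exact hasMultiplicativeReductionAtPrime_baseChange_int_of_isCoprime _ M15_coprime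
    (by rw [fifteenA1_int_Δ]; decide)

/-- **`ord₃ Δ_min(15a1) = 4`** (so `3 ∤ ord₃ Δ_min`: the bucket-B side condition).
[cite: CremonaAlgorithms1997, Table 1 (curve 15a1)] -/
theorem padicValInt_three_15a1 :
    haveI := isGloballyMinimal_15a1
    padicValInt 3 ((⟨1, 1, 1, -10, -10⟩ : WeierstrassCurve ℤ).baseChange ℚ).minimalDiscriminantInt = 4 := by
  haveI := isGloballyMinimal_15a1
  rw [IntModel.minimalDiscriminantInt_eq integralModelInt_15a1, fifteenA1_int_Δ]
  exact IntModel.padicValInt_eq_of_dvd_of_not_dvd 3 (e := 4) (by norm_num) (by norm_num)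

/-- `#Ẽ(𝔽₇) = 8` for `15a1` (`a₇ = 0`). [cite: IrelandRosen1990, Prop. 5.1.2 and §8.1] -/
theorem card_15a1_mod7 [Fact (Nat.Prime 7)] :
    Nat.card (((⟨1, 1, 1, -10, -10⟩ : WeierstrassCurve ℤ).map (Int.castRingHom (ZMod 7))).toAffine.Point) = 8 := by
  have h := natCard_point_eq_countPoints 1 1 1 (-10) (-10) 7 (by norm_num) (by rw [fifteenA1_int_Δ]; decide)
  have h' : countPoints [1, 1, 1, -10, -10] 7 = 8 := by decide +kernel
  exact_mod_cast h.trans h'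

/-- `#Ẽ(𝔽₃₇) = 48` for `15a1` (`a₃₇ = −10`). [cite: IrelandRosen1990, Prop. 5.1.2 and §8.1] -/
theorem card_15a1_mod37 [Fact (Nat.Prime 37)] :
    Nat.card (((⟨1, 1, 1, -10, -10⟩ : WeierstrassCurve ℤ).map (Int.castRingHom (ZMod 37))).toAffine.Point) = 48 := by
  have h := natCard_point_eq_countPoints 1 1 1 (-10) (-10) 37 (by norm_num) (by rw [fifteenA1_int_Δ]; decide)
  have h' : countPoints [1, 1, 1, -10, -10] 37 = 48 := by decide +kernel
  exact_mod_cast h.trans h'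

/-- **`ρ̄_{15a1,3}` is ONTO `GL₂(𝔽₃)`** (kernel): irreducible by `ℓ₁ = 7` (`a₇ = 0`, `X² + 7` has no
root mod `3`); an element of order `3` by `ℓ₂ = 37` (`ℓ₂ ≡ 1`, `a₃₇ = −10 ≡ 2 (mod 3)`, `9 ∤ 48 = #Ẽ(𝔽₃₇)`).
[cite: Serre1972, §2.4 Prop. 15, §2.8 Prop. 19] -/
theorem surj_three_15a1 : ((⟨1, 1, 1, -10, -10⟩ : WeierstrassCurve ℤ).baseChange ℚ).HasSurjectiveModNGaloisRep 3 := by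
  haveI := isElliptic_15a1
  haveI := isGloballyMinimal_15a1
  haveI : Fact (Nat.Prime 7) := ⟨by norm_num⟩
  haveI : Fact (Nat.Prime 37) := ⟨by norm_num⟩
  exact hasSurjectiveModNGaloisRep_of_intModel_of_irr_of_order integralModelInt_15a1 3 7 37
    (by norm_num) (by norm_num) (by rw [fifteenA1_int_Δ]; decide) (by rw [fifteenA1_int_Δ]; decide)
    card_15a1_mod7 card_15a1_mod37 (by decide) (by decide) (by decide) (by decide)

/-! ### §2 The bucket-B habitat: `15a1` over `K` of discriminant `−11` -/

/-- An imaginary quadratic field of discriminant `−11` exists (as a `Type`). [cite: Marcus1977, Ch. 2 Thm. 1] -/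
theorem exists_field_discr_neg11 :
    ∃ (K : Type) (_ : Field K) (_ : NumberField K), IsImaginaryQuadratic K ∧ NumberField.discr K = -11 := by
  obtain ⟨K, _, _, hK2, hd⟩ :=
    Literature.NumberTheory.QuadraticFields.Quadratic.exists_numberField_discr_eq (D := -11)
      (Or.inl ⟨by norm_num, Int.squarefree_natAbs.mp (by decide +kernel), by norm_num⟩)
  exact ⟨K, _, _, isImaginaryQuadratic_iff_discr_neg.2 ⟨hK2, by rw [hd]; norm_num⟩, hd⟩

/-- `K` of discriminant `−11` satisfies the Heegner hypothesis for `15`: `(−11/3) = (−11/5) = 1`.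
[cite: GrossLMS1991, §1 (p. 235)] -/
theorem heegner_15_of_discr_neg11 {K : Type} [Field K] [NumberField K] (hK : IsImaginaryQuadratic K)
    (hd : NumberField.discr K = -11) : SatisfiesHeegnerHypothesis 15 K := by
  rw [satisfiesHeegnerHypothesis_iff_kronecker 15 K hK.1, hd]
  intro p hp hpN
  have hp35 : p = 3 ∨ p = 5 := by
    rcases (Nat.Prime.dvd_mul hp).mp (show p ∣ 3 * 5 from hpN) with h | h
    · exact Or.inl ((Nat.prime_dvd_prime_iff_eq hp Nat.prime_three).mp h)
    · exact Or.inr ((Nat.prime_dvd_prime_iff_eq hp (by norm_num)).mp h)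
  rcases hp35 with rfl | rfl
  · exact ⟨fun h ↦ absurd h (by norm_num), fun _ ↦ by norm_num⟩
  · exact ⟨fun h ↦ absurd h (by norm_num), fun _ ↦ by norm_num⟩

/-- **BUCKET-B HABITAT of `TwinAlgMuZeroAtThree`.** Every hypothesis of the crux other than the
(unused) modular-parametrisation binder `Dt'` is met SIMULTANEOUSLY, in the kernel: `E' = 15a1`
(multiplicative at `3`, `ord₃ Δ_min = 4`, `ρ̄₃` onto, `N = 15`), `K` imaginary quadratic of
discriminant `−11` (Heegner for `15`, odd), an anticyclotomic `ℤ₃`-extension `κ` with a topological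
generator `γ`, a degree-one prime `𝔭 ∣ 3` and a second prime `𝔭' ∣ 3`, `𝔭' ≠ 𝔭`. So the crux is
not vacuous on bucket B: a proof must deliver `Λ`-torsion and `μ = 0` of `X_{∅,0}(15a1/K_∞)`.
[cite: CremonaAlgorithms1997, Table 1 (curve 15a1)] -/
theorem exists_bucketB_antecedents :
    ∃ (W' : WeierstrassCurve ℚ) (_ : W'.IsElliptic) (_ : W'.IsGloballyMinimal)
      (K : Type) (_ : Field K) (_ : NumberField K)
      (κ : ZpExtension K 3) (γ : Field.absoluteGaloisGroup K)
      (𝔭 𝔭' : HeightOneSpectrum (𝓞 K)),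
      (Mult W' 3 ∧ ¬ 3 ∣ padicValInt 3 W'.minimalDiscriminantInt) ∧
      W'.HasSurjectiveModNGaloisRep 3 ∧ W'.conductorNorm ℤ = 15 ∧
      IsImaginaryQuadratic K ∧ SatisfiesHeegnerHypothesis 15 K ∧ Odd (NumberField.discr K) ∧
      κ.IsAnticyclotomic ∧ κ.IsTopGenerator γ ∧
      ((3 : ℕ) : 𝓞 K) ∈ 𝔭.asIdeal ∧ 𝔭.asIdeal.ramificationIdx (𝓞 ℚ) = 1 ∧
      𝔭.asIdeal.inertiaDeg (𝓞 ℚ) = 1 ∧ ((3 : ℕ) : 𝓞 K) ∈ 𝔭'.asIdeal ∧ 𝔭' ≠ 𝔭 := by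
  obtain ⟨K, _, _, hK, hd⟩ := exists_field_discr_neg11
  have hH : SatisfiesHeegnerHypothesis 15 K := heegner_15_of_discr_neg11 hK hd
  obtain ⟨κ, γ, -, hκ, hγ, -⟩ := exists_anticyclotomic_generator_prime (p := 3) hK
  obtain ⟨𝔭, 𝔭', h𝔭, he, hf, h𝔭', hne⟩ :=
    exists_two_primes_of_splitsIn hK.1 (splitsIn_three_of_heegner (by norm_num) hH)
  haveI := isElliptic_15a1
  haveI := isGloballyMinimal_15a1
  exact ⟨_, isElliptic_15a1, isGloballyMinimal_15a1, K, _, _, κ, γ, 𝔭, 𝔭',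
    ⟨mult_three_15a1, by rw [padicValInt_three_15a1]; decide⟩, surj_three_15a1, conductorNorm_15a1,
    hK, hH, by rw [hd]; decide, hκ, hγ, h𝔭, he, hf, h𝔭', hne⟩

/-- **The same habitat with the modular parametrisation binder**, under the displayed named fact
`nonempty_modularParametrizationData` (modularity of `E/ℚ`, Breuil–Conrad–Diamond–Taylor): ALL binders
and hypotheses of `TwinAlgMuZeroAtThree` are then met at `(15a1, K)` with `N' = N_{15a1} = 15`.
[cite: BCDTJAMS2001, Thm. A] -/
theorem exists_bucketB_antecedents_with_parametrization (hmodD : nonempty_modularParametrizationData) :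
    ∃ (W' : WeierstrassCurve ℚ) (_ : W'.IsElliptic) (_ : W'.IsGloballyMinimal) (N' : ℕ) (_ : NeZero N')
      (K : Type) (_ : Field K) (_ : NumberField K) (_ : ModularParametrizationData W' N')
      (κ : ZpExtension K 3) (γ : Field.absoluteGaloisGroup K)
      (𝔭 𝔭' : HeightOneSpectrum (𝓞 K)),
      (Mult W' 3 ∧ ¬ 3 ∣ padicValInt 3 W'.minimalDiscriminantInt) ∧
      W'.HasSurjectiveModNGaloisRep 3 ∧ W'.conductorNorm ℤ = N' ∧
      IsImaginaryQuadratic K ∧ SatisfiesHeegnerHypothesis N' K ∧ Odd (NumberField.discr K) ∧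
      κ.IsAnticyclotomic ∧ κ.IsTopGenerator γ ∧
      ((3 : ℕ) : 𝓞 K) ∈ 𝔭.asIdeal ∧ 𝔭.asIdeal.ramificationIdx (𝓞 ℚ) = 1 ∧
      𝔭.asIdeal.inertiaDeg (𝓞 ℚ) = 1 ∧ ((3 : ℕ) : 𝓞 K) ∈ 𝔭'.asIdeal ∧ 𝔭' ≠ 𝔭 := by
  obtain ⟨W', hE, hM, K, iF, iN, κ, γ, 𝔭, 𝔭', hB, hsurj, hN, hK, hH, hodd, hκ, hγ, h𝔭, he, hf, h𝔭', hne⟩ :=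
    exists_bucketB_antecedents
  have hNZ : NeZero (W'.conductorNorm ℤ) := ⟨by rw [hN]; norm_num⟩
  obtain ⟨Dt⟩ := hmodD W'
  exact ⟨W', hE, hM, W'.conductorNorm ℤ, hNZ, K, iF, iN, Dt, κ, γ, 𝔭, 𝔭', hB, hsurj, rfl, hK,
    by rw [hN]; exact hH, hodd, hκ, hγ, h𝔭, he, hf, h𝔭', hne⟩

end Summit.BirchSwinnertonDyer.BirchSwinnertonDyer.Theorems.TwinAlgMuZeroAtThree.Negative

end
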